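import Literature.NumberTheory.Automorphic.TotallyRealModularityLargeImage
import HarnessLib

/-!
# Modularity of elliptic curves over totally real quartic fields with small residual images:
# Box's four `b5`-curves (Box 2022, Thm. 1.5 with Thm. 1.4)

Topic `Literature/NumberTheory/Automorphic`; companion of `TotallyRealModularity.lean` (named
facts `FLS2015_theorem1`, `FLS2015_theorem5`, `DNS2020_theorem4`, `Box2022_theorem1_1`, rendering
of "modular" = `IsAutomorphicOfWeightZero E`) and of `TotallyRealModularityLargeImage.lean`
(carriers), of `FreitasLeHungSiksekLifting.lean` / `TotallyRealNonModularImages.lean` (the named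
facts `FLS2015_theorems3_4` — FLS 2015 Thms. 3–4 — and `Box2022_theorem1_3`, landed 2026-08-16) and of
`TotallyRealModularityBoxImages.lean`. ONE named fact (D-0014; users take `(h : FactName)`),
vendored by a grounder for route `Langlands/SqrtFiveQuarticCovers` (modularity of elliptic curves
over totally real QUARTIC fields containing `√5`):

* `Box2022_theorem1_5_modular` — J. Box, *Elliptic curves over totally real quartic fields not
  containing `√5` are modular*, Trans. Amer. Math. Soc. 375 (2022) = arXiv:2103.13975 (held text
  `paper:arxiv-2103.13975`), the COROLLARY printed on p. 5 of the text of **Theorem 1.5** ("On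
  `X(b3,b5,b7) = X₀(105)` and `X(s3,b5,b7)`, all quartic points with quartic `j`-invariant are
  `ℚ`-curves. On `X(b3,b5,e7)` and `X(s3,b5,e7)`, all quartic points with quartic `j`-invariant
  are either `ℚ`-curves, or have a non-totally real `j`-invariant displayed in Table 1"), of
  **Theorem 1.4** (Ribet: "Every `ℚ`-curve is modular") and of the paragraph preceding Thm. 1.5
  ("It thus suffices to find the quartic points on those curves. In fact, it suffices to find the
  quartic points `P` whose `j`-invariant `j(P)` also has degree `4`: if smaller, then `P` is
  supported on an elliptic curve `E` that either has `j`-invariant `0` or `1728` and hence is a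
  `ℚ`-curve, or is a quadratic twist `E = E' ⊗ χ` … `E'` is known to be modular … then `E` is also
  modular"), together with the moduli interpretation of §1.1 ("If `E` is an elliptic curve over `K`
  such that `Im(ρ̄_{E,N}) ⊂ G` up to conjugation, then there exists `Q ∈ Y_G(K)` with
  `j(Q) = j_E`") and the sectional results Thm. 3.1 (`X₀(105)`, p. 12), Thm. 4.1 (`X(s3,b5,b7)`,
  p. 17), Thm. 6.1 with Cor. 5.3 (the two `e7`-curves, pp. 20–25): **for EVERY totally real quartic
  field `K` (no hypothesis on `√5`: Thm. 1.5 is a statement about all quartic points of the four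
  curves) and every elliptic curve `E / K` whose mod-`3` image is contained in `B(3)` or
  `C_s⁺(3)`, whose mod-`5` image is contained in `B(5)` and whose mod-`7` image is contained in
  `B(7)` or `G(e7) = ⟨(0 5; 3 0), (5 0; 3 2)⟩` (each up to conjugacy), `E` is modular.**  In Box's
  proof of Thm. 1.1 the hypothesis `√5 ∉ K` enters only through Thm. 1.3 (ii) (Thorne), which
  places the mod-`5` image in `B(5)`; §7.1 of the source (p. 30) confirms that for `√5 ∈ K` the
  four `b5`-curves are four of the sixteen curves `X(u3, v5, w7)` to be treated and raises no
  further issue about them. Grounds `Summit.Langlands.Langlands.Theses.SqrtFiveQuarticCovers.BoxBorelFive`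
  (that item = this fact specialised to `√5 ∈ K`, composed with the proved bridges
  `IsHilbertModular.of_isAutomorphicOfWeightZero` / `IsHilbertModular.isModularEllipticCurve`).

## Rendering

* "modular" = `IsAutomorphicOfWeightZero E` for an integral model `E / 𝓞 K` with `Δ(E) ≠ 0`
  (module docstring of `TotallyRealModularity.lean`, "Rendering and faithfulness").
* "`Im(ρ̄_{E,p}) ⊂ G` up to conjugacy" = there is a framing `ρ̄ : Γ_K →ₜ* GL₂(ZMod p)` of the
  Galois action on the geometric `p`-torsion of `E` (`WeierstrassCurve.IsTorsionGaloisRep`, file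
  `BCDTModularity.lean`; all framings are `GL₂(𝔽_p)`-conjugate) whose values all lie in `G`.
  `B(p)` = upper-triangular matrices (entry `(1,0)` vanishes); `C_s⁺(3) = ⟨diag(1,2), (0 1; 1 0)⟩`
  (order `8`, FLS Part 4 Prop. 1.1 (a), p. 19 of the arXiv text); `G(e7) = ⟨(0 5; 3 0), (5 0; 3 2)⟩`
  (Box §1.2 = the group `H₂` of FLS Part 4 Prop. 1.1 (c), order `48`). These are the renderings used verbatim by the route
  file `Summits/Langlands/Langlands/Theses/SqrtFiveQuarticCovers.lean`.
* Faithfulness of `Box2022_theorem1_5_modular`: WEAKER than print only in dropping the explicit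
  list of exceptional `j`-invariants (they are not totally real, so no `E` over a totally real `K`
  has them) and in concluding modularity rather than "`ℚ`-curve"; NOT stronger: every `E` in its
  hypothesis gives a `K`-point `P` on one of the four curves (§1.1), with `ℚ(P) ⊆ K` of degree
  `1`, `2` or `4`, and the printed case analysis (p. 5) covers each degree.

## References

* [FreitasLeHungSiksek2015] Invent. Math. 201 (2015) 159–206, Thms. 3, 4 (pp. 4–5 of the held
  arXiv text), proof of Thm. 2 (p. 8), Prop. 3.1 and Lemma 3.2 (p. 10), Part 4 Prop. 1.1 and
  Cor. 2.1 with Remark (iii) (pp. 19–20).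
* [Box2022] Trans. AMS 375 (2022), doi:10.1090/tran/8557 = arXiv:2103.13975: §1.1, Thms. 1.3–1.5
  (pp. 3–5), Thm. 3.1 (p. 12), Thm. 4.1 (p. 17), Cor. 5.3, Thm. 6.1 (pp. 20–25), Thm. 7.1 (p. 30).
* [Ribet2004QCurves] K. Ribet, *Abelian varieties over `ℚ` and modular forms*, in: Modular curves
  and abelian varieties, Progr. Math. 224 (2004) 241–261 (Box's [ribet], Thm. 1.4).
-/

open scoped NumberField MatrixGroups
open NumberField Literature.NumberTheory.GaloisRepresentations

noncomputable section

namespace Literature.NumberTheory.Automorphic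

/-- **Box (2022), Theorem 1.5 with Theorem 1.4 (Ribet) and §1.2: elliptic curves over a totally
real quartic field with mod-`3` image in `B(3)` or `C_s⁺(3)`, mod-`5` image in `B(5)` and mod-`7`
image in `B(7)` or `G(e7)` are modular.** Printed form: Thm. 1.5 "On `X(b3,b5,b7) = X₀(105)` and
`X(s3,b5,b7)`, all quartic points with quartic `j`-invariant are `ℚ`-curves. On `X(b3,b5,e7)` and
`X(s3,b5,e7)`, all quartic points with quartic `j`-invariant are either `ℚ`-curves, or have a
non-totally real `j`-invariant displayed in Table 1"; Thm. 1.4 "Every `ℚ`-curve is modular"; p. 5: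
points of smaller-degree `j`-invariant carry `j ∈ {0, 1728}` (a `ℚ`-curve) or a quadratic twist of
a curve over a field of degree `≤ 2`, "known to be modular … then `E` is also modular"; §1.1: an
`E / K` with `Im(ρ̄_{E,N}) ⊂ G` up to conjugacy gives `Q ∈ Y_G(K)` with `j(Q) = j_E`. Rendered
(module docstring "Rendering"): for `K` totally real with `[K : ℚ] = 4` — NO hypothesis on `√5`,
Thm. 1.5 being a statement about all quartic points of the four curves — and `E / 𝓞 K` with
`Δ(E) ≠ 0` admitting framings `ρ̄₃, ρ̄₅, ρ̄₇` of `E[3], E[5], E[7]`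
(`WeierstrassCurve.IsTorsionGaloisRep`) with `ρ̄₃(Γ_K) ⊆ B(3)` or `⊆ C_s⁺(3) = ⟨diag(1,2), (0 1; 1 0)⟩`,
`ρ̄₅(Γ_K) ⊆ B(5)`, and `ρ̄₇(Γ_K) ⊆ B(7)` or `⊆ G(e7) = ⟨(0 5; 3 0), (5 0; 3 2)⟩`, the curve is
automorphic of weight zero (`IsAutomorphicOfWeightZero E`). Weaker than print only in its
conclusion (modular, not "`ℚ`-curve") — see "Faithfulness" in the module docstring. A named fact
(D-0014): users take `(h : Box2022_theorem1_5_modular)`. Grounds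
`Summit.Langlands.Langlands.Theses.SqrtFiveQuarticCovers.BoxBorelFive` (= this fact at `√5 ∈ K`,
through `IsHilbertModular.of_isAutomorphicOfWeightZero` and `.isModularEllipticCurve`).
[cite: Box2022, Thm. 1.5, Thm. 1.4, §1.1–1.2 (p. 5), Thms. 3.1, 4.1, 6.1] -/
def Box2022_theorem1_5_modular : Prop :=
  ∀ (K : Type) [Field K] [NumberField K] [IsTotallyReal K], Module.finrank ℚ K = 4 →
    ∀ E : WeierstrassCurve (𝓞 K), E.Δ ≠ 0 →
      (∃ ρ : FramedGaloisRep K (ZMod 3) 2, (E.baseChange K).IsTorsionGaloisRep 3 ρ ∧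
        ((∀ σ : Field.absoluteGaloisGroup K,
            ((ρ σ : GL (Fin 2) (ZMod 3)) : Matrix (Fin 2) (Fin 2) (ZMod 3)) 1 0 = 0) ∨
          (∀ σ : Field.absoluteGaloisGroup K, (ρ σ : GL (Fin 2) (ZMod 3)) ∈
            Subgroup.closure ({(⟨!![1, 0; 0, 2], !![1, 0; 0, 2], by decide, by decide⟩ :
                GL (Fin 2) (ZMod 3)),
              (⟨!![0, 1; 1, 0], !![0, 1; 1, 0], by decide, by decide⟩ : GL (Fin 2) (ZMod 3))} :
              Set (GL (Fin 2) (ZMod 3)))))) →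
      (∃ ρ : FramedGaloisRep K (ZMod 5) 2, (E.baseChange K).IsTorsionGaloisRep 5 ρ ∧
        ∀ σ : Field.absoluteGaloisGroup K,
          ((ρ σ : GL (Fin 2) (ZMod 5)) : Matrix (Fin 2) (Fin 2) (ZMod 5)) 1 0 = 0) →
      (∃ ρ : FramedGaloisRep K (ZMod 7) 2, (E.baseChange K).IsTorsionGaloisRep 7 ρ ∧
        ((∀ σ : Field.absoluteGaloisGroup K,
            ((ρ σ : GL (Fin 2) (ZMod 7)) : Matrix (Fin 2) (Fin 2) (ZMod 7)) 1 0 = 0) ∨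
          (∀ σ : Field.absoluteGaloisGroup K, (ρ σ : GL (Fin 2) (ZMod 7)) ∈
            Subgroup.closure ({(⟨!![0, 5; 3, 0], !![0, 5; 3, 0], by decide, by decide⟩ :
                GL (Fin 2) (ZMod 7)),
              (⟨!![5, 0; 3, 2], !![3, 0; 6, 4], by decide, by decide⟩ : GL (Fin 2) (ZMod 7))} :
              Set (GL (Fin 2) (ZMod 7)))))) →
      IsAutomorphicOfWeightZero E

/-- Box's `b5`-locus theorem gives modularity in the cofinite Hilbert sense `IsHilbertModular`
(`IsHilbertModular.of_isAutomorphicOfWeightZero`). [cite: Box2022, Thm. 1.5 and Thm. 1.4] -/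
theorem Box2022_theorem1_5_modular.isHilbertModular (h : Box2022_theorem1_5_modular) (K : Type)
    [Field K] [NumberField K] [IsTotallyReal K] (hd : Module.finrank ℚ K = 4)
    {E : WeierstrassCurve (𝓞 K)} (hE : E.Δ ≠ 0)
    (h3 : ∃ ρ : FramedGaloisRep K (ZMod 3) 2, (E.baseChange K).IsTorsionGaloisRep 3 ρ ∧
        ((∀ σ : Field.absoluteGaloisGroup K,
            ((ρ σ : GL (Fin 2) (ZMod 3)) : Matrix (Fin 2) (Fin 2) (ZMod 3)) 1 0 = 0) ∨
          (∀ σ : Field.absoluteGaloisGroup K, (ρ σ : GL (Fin 2) (ZMod 3)) ∈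
            Subgroup.closure ({(⟨!![1, 0; 0, 2], !![1, 0; 0, 2], by decide, by decide⟩ :
                GL (Fin 2) (ZMod 3)),
              (⟨!![0, 1; 1, 0], !![0, 1; 1, 0], by decide, by decide⟩ : GL (Fin 2) (ZMod 3))} :
              Set (GL (Fin 2) (ZMod 3))))))
    (h5 : ∃ ρ : FramedGaloisRep K (ZMod 5) 2, (E.baseChange K).IsTorsionGaloisRep 5 ρ ∧
        ∀ σ : Field.absoluteGaloisGroup K,
          ((ρ σ : GL (Fin 2) (ZMod 5)) : Matrix (Fin 2) (Fin 2) (ZMod 5)) 1 0 = 0)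
    (h7 : ∃ ρ : FramedGaloisRep K (ZMod 7) 2, (E.baseChange K).IsTorsionGaloisRep 7 ρ ∧
        ((∀ σ : Field.absoluteGaloisGroup K,
            ((ρ σ : GL (Fin 2) (ZMod 7)) : Matrix (Fin 2) (Fin 2) (ZMod 7)) 1 0 = 0) ∨
          (∀ σ : Field.absoluteGaloisGroup K, (ρ σ : GL (Fin 2) (ZMod 7)) ∈
            Subgroup.closure ({(⟨!![0, 5; 3, 0], !![0, 5; 3, 0], by decide, by decide⟩ :
                GL (Fin 2) (ZMod 7)),
              (⟨!![5, 0; 3, 2], !![3, 0; 6, 4], by decide, by decide⟩ : GL (Fin 2) (ZMod 7))} :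
              Set (GL (Fin 2) (ZMod 7)))))) :
    IsHilbertModular E :=
  IsHilbertModular.of_isAutomorphicOfWeightZero hE (h K hd E hE h3 h5 h7)

end Literature.NumberTheory.Automorphic

end
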